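import Mathlib
import HarnessLib
import Literature.AlgebraicGeometry.Ramification.InertiaNormalSylow
import Literature.AlgebraicGeometry.Resolution.BlowupsEquivariant
import Literature.AlgebraicGeometry.Resolution.BlowupChartMembership
import Literature.AlgebraicGeometry.Resolution.ExceptionalDivisorProjectiveBundle
import Literature.AlgebraicGeometry.Resolution.PermissibleCentres
import Summits.ResolutionOfSingularities.ResolutionOfSingularities.Theorems.WildQuotientsWildQuotientResolutionKSBlowupLiftFixedPoint

/-!
# Kollár–Szabó going down, blow-up step (K2-scheme, local chart): a local ring `R` over `𝒪_{X,x}` with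
# `𝔪_x R = (t)` maps to the point blow-up, equivariantly; its closed point gives an `H`-fixed point with inertia
# (crux `WildQuotients.WildQuotientResolution`, stub `stub_phaseZeroHighDim`)

Crux stmt-ResolutionOfSingularities-15640 (`WildQuotientResolution`), registered stub `stub_phaseZeroHighDim`;
programme PHASE0-KS-EIGENLINE, target `hstep` of ✓`KSGoingDown.kollarSzaboGoingDown_of_step`. After
✓`KSBlowupLiftFixedPoint` (p828542: lifts to a blow-up are equivariant; inertia at the image of a fixed
field-valued point) this file provides the LOCAL CHART to which that mechanism is applied. For a blowing up
`π : X' → X` along the reduced closed point `{x}` and ANY ring map `ι : 𝒪_{X,x} → R` with `𝔪_x · R = (t)`,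
`t` a non-zero-divisor (e.g. `R = S[𝔪/t]_𝔫`, a quadratic transform of `S = 𝒪_{X,x}`,
✓`EigenlineChart.exists_equivariant_quadraticTransform`):

* `isEffectiveCartier_comap_specMap_fromSpecStalk` — `Spec R → Spec 𝒪_{X,x} → X` pulls `𝓘_{x}` back to the
  effective Cartier divisor `(t)~` (tree: ✓`comap_fromSpecStalk_eq_affineBlowupIdealSheaf`,
  ✓`stalkIdeal_vanishingIdeal_singleton`, ✓`comap_idealSheaf_specMap`,
  ✓`affineBlowup.isEffectiveCartier_idealSheaf_span_singleton`);
* `exists_localChart` — hence a morphism `φ : Spec R → X'` over `Spec R → X` (✓`IsBlowup.lift`);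
* `specMap_comp_fromSpecStalk_equivariant` — if ring endomorphisms `α_g` of `R` extend a stalk action
  `a_g` of `G` at `x` (`α_g ∘ ι = ι ∘ a_g`, `Spec(a_g) ≫ ι_x = ι_x ≫ σ_g`), then `Spec α_g` lies over `σ_g`;
* `specMap_residue_comp_eq_of_sub_mem` — if `α_g` is RESIDUE-TRIVIAL (`α_g r − r ∈ 𝔪_R`), the closed point
  `Spec κ(R) → Spec R` is fixed by `Spec α_g`;
* `exists_fixedPoint_of_localChart` — **conclusion**: for an action `σ'` on `X'` over an action `σ` on `X`
  fixing `x`, there is a point `x' ∈ X'` over `x`, the image of the closed point of `Spec R`, with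
  `g ∈ I_{x'}` (inertia of `σ'`) for every `g`; `exists_fixedPoint_liftAction_of_localChart` — the same for
  the lifted action ✓`IsBlowup.liftAction`.

What remains for `hstep` after this file (memo of hand 8-g2 in NOTES/bus): the `K`-model glue producing
`(R, ι, t, α)` from ✓`PointBlowupStalkData.exists_stalkAction` + ✓`AbelianEigenline` + ✓`EigenlineChart` (8-g1),
and the local structure of `x'` (closed, regular of dimension `dim 𝒪_{X,x}`, via ✓`exists_axialPoint` /
✓`IsBlowup.exists_chart_morphism_of_index`).

[OURS · crux stmt-ResolutionOfSingularities-15640 · helper toward `stub_phaseZeroHighDim` (local chart of the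
fixed point in the abstract blow-up step of Kollár–Szabó going down; NOT a proof of the stub); folklore
(Stacks 0804), counted 0; AI-level work, weaker than expert review.] [folklore]
-/

-- single-problem summit: the doubled namespace component `ResolutionOfSingularities` is forced
set_option linter.dupNamespace false

noncomputable section

open CategoryTheory CategoryTheory.Limits AlgebraicGeometry TopologicalSpace IsLocalRing
open Literature.AlgebraicGeometry.Ramification Literature.AlgebraicGeometry.Resolution
open Scheme.IdealSheafData

namespace Summit.ResolutionOfSingularities.ResolutionOfSingularities.Theorems.WildQuotientResolution.KSGoingDown

universe u

variable {X' X : Scheme.{u}} {π : X' ⟶ X} {x : X}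

/-! ## The local chart pulls the centre back to an effective Cartier divisor -/

/-- **`Spec R → Spec 𝒪_{X,x} → X` pulls the reduced closed point `{x}` back to an effective Cartier divisor**
as soon as `𝔪_x · R = (t)` with `t` a non-zero-divisor of `R`: the pulled-back ideal sheaf is `(𝔪_x R)~ = (t)~`.
[cite: StacksProject, Tag 0804] -/
theorem isEffectiveCartier_comap_specMap_fromSpecStalk (hx : IsClosed ({x} : Set X))
    {R : Type u} [CommRing R] (ι : X.presheaf.stalk x →+* R) {t : R} (ht : t ∈ nonZeroDivisors R)
    (hmap : (maximalIdeal (X.presheaf.stalk x)).map ι = Ideal.span {t}) :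
    IsEffectiveCartier ((vanishingIdeal ⟨{x}, hx⟩).comap
      (Spec.map (CommRingCat.ofHom ι) ≫ X.fromSpecStalk x)) := by
  rw [Scheme.IdealSheafData.comap_comp, comap_fromSpecStalk_eq_affineBlowupIdealSheaf,
    stalkIdeal_vanishingIdeal_singleton hx, comap_idealSheaf_specMap, hmap]
  exact affineBlowup.isEffectiveCartier_idealSheaf_span_singleton ht

/-- **The local chart of the blow-up**: a morphism `φ : Spec R → X'` over `Spec R → Spec 𝒪_{X,x} → X`
(universal property ✓`IsBlowup.lift`). [cite: StacksProject, Tag 0804] -/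
theorem exists_localChart (hx : IsClosed ({x} : Set X)) (hπ : IsBlowup π (vanishingIdeal ⟨{x}, hx⟩))
    {R : Type u} [CommRing R] (ι : X.presheaf.stalk x →+* R) {t : R} (ht : t ∈ nonZeroDivisors R)
    (hmap : (maximalIdeal (X.presheaf.stalk x)).map ι = Ideal.span {t}) :
    ∃ φ : Spec (.of R) ⟶ X', φ ≫ π = Spec.map (CommRingCat.ofHom ι) ≫ X.fromSpecStalk x :=
  ⟨hπ.lift _ (isEffectiveCartier_comap_specMap_fromSpecStalk hx ι ht hmap), hπ.lift_comp _ _⟩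

/-! ## Equivariance of the local chart and its fixed closed point -/

/-- If ring endomorphisms `α_g` of `R` extend, along `ι : 𝒪_{X,x} → R`, a stalk action `a_g` of `G` at `x`
compatible with the action `σ` on `X` (`Spec(a_g) ≫ ι_x = ι_x ≫ σ_g`, as produced by
✓`PointBlowupStalkData.exists_stalkAction`), then `Spec α_g` lies over `σ_g` through `Spec R → X`. [folklore] -/
theorem specMap_comp_fromSpecStalk_equivariant {G : Type*} (σ : G → (X ⟶ X))
    (a : G → (X.presheaf.stalk x ⟶ X.presheaf.stalk x))
    (hkey : ∀ g, Spec.map (a g) ≫ X.fromSpecStalk x = X.fromSpecStalk x ≫ σ g)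
    {R : Type u} [CommRing R] (ι : X.presheaf.stalk x →+* R) (α : G → (R →+* R))
    (hα : ∀ g, (α g).comp ι = ι.comp (a g).hom) (g : G) :
    Spec.map (CommRingCat.ofHom (α g)) ≫ (Spec.map (CommRingCat.ofHom ι) ≫ X.fromSpecStalk x) =
      (Spec.map (CommRingCat.ofHom ι) ≫ X.fromSpecStalk x) ≫ σ g := by
  have h1 : Spec.map (CommRingCat.ofHom (α g)) ≫ Spec.map (CommRingCat.ofHom ι) =
      Spec.map (CommRingCat.ofHom ι) ≫ Spec.map (a g) := by
    rw [← Spec.map_comp, ← Spec.map_comp]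
    congr 1
    ext r
    exact RingHom.congr_fun (hα g) r
  rw [← Category.assoc, h1, Category.assoc, hkey g, Category.assoc]

/-- If a ring endomorphism `α` of a local ring `R` is RESIDUE-TRIVIAL (`α r − r ∈ 𝔪_R` for all `r`), then the
closed point `Spec κ(R) → Spec R` is fixed by `Spec α`. [folklore] -/
theorem specMap_residue_comp_eq_of_sub_mem {R : Type u} [CommRing R] [IsLocalRing R] (α : R →+* R)
    (hres : ∀ r : R, α r - r ∈ maximalIdeal R) :
    Spec.map (CommRingCat.ofHom (residue R)) ≫ Spec.map (CommRingCat.ofHom α) =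
      Spec.map (CommRingCat.ofHom (residue R)) := by
  rw [← Spec.map_comp]
  congr 1
  ext r
  change residue R (α r) = residue R r
  rw [← sub_eq_zero, ← map_sub, residue_eq_zero_iff]
  exact hres r

/-- The closed point of `Spec R` maps to `x` under `Spec R → Spec 𝒪_{X,x} → X` when `ι` is local. [folklore] -/
theorem specMap_comp_fromSpecStalk_closedPoint {R : Type u} [CommRing R] [IsLocalRing R]
    (ι : X.presheaf.stalk x →+* R) [IsLocalHom ι] :
    (Spec.map (CommRingCat.ofHom ι) ≫ X.fromSpecStalk x) (closedPoint R) = x := by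
  haveI : IsLocalHom (CommRingCat.ofHom ι).hom := ‹IsLocalHom ι›
  rw [Scheme.Hom.comp_apply, Spec_closedPoint, Scheme.fromSpecStalk_closedPoint]

/-- **The fixed point with inertia from an equivariant local chart.** Let `π : X' → X` be a blowing up along
the reduced closed point `{x}`, `σ` an action of `G` on `X` fixing `x` (`σ_g⁻¹ {x} = {x}`), `σ'` an action on
`X'` over `σ`, and `a_g` a stalk action at `x` over `σ` (`Spec(a_g) ≫ ι_x = ι_x ≫ σ_g`). Let `ι : 𝒪_{X,x} → R` be
a LOCAL map to a local ring with `𝔪_x R = (t)`, `t` a non-zero-divisor, carrying residue-trivial ring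
endomorphisms `α_g` extending the `a_g`. Then the closed point of `Spec R` maps, under the local chart
`φ : Spec R → X'`, to a point `x'` over `x` at which every `g` lies in the inertia group of `σ'`.
[cite: ReichsteinYoussin2000, Appendix, proof of Prop. A.2] -/
theorem exists_fixedPoint_of_localChart (hx : IsClosed ({x} : Set X))
    (hπ : IsBlowup π (vanishingIdeal ⟨{x}, hx⟩)) {G : Type u} [Group G] (σ : G →* Aut X)
    (hσx : ∀ g, (σ g).hom.base ⁻¹' ({x} : Set X) = {x})
    (σ' : G →* Aut X') (hσ' : ∀ g, (σ' g).hom ≫ π = π ≫ (σ g).hom)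
    (a : G → (X.presheaf.stalk x ⟶ X.presheaf.stalk x))
    (hkey : ∀ g, Spec.map (a g) ≫ X.fromSpecStalk x = X.fromSpecStalk x ≫ (σ g).hom)
    {R : Type u} [CommRing R] [IsLocalRing R] (ι : X.presheaf.stalk x →+* R) [IsLocalHom ι]
    {t : R} (ht : t ∈ nonZeroDivisors R) (hmap : (maximalIdeal (X.presheaf.stalk x)).map ι = Ideal.span {t})
    (α : G → (R →+* R)) (hα : ∀ g, (α g).comp ι = ι.comp (a g).hom)
    (hres : ∀ (g : G) (r : R), α g r - r ∈ maximalIdeal R) :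
    ∃ (φ : Spec (.of R) ⟶ X') (x' : X'),
      φ ≫ π = Spec.map (CommRingCat.ofHom ι) ≫ X.fromSpecStalk x ∧ φ (closedPoint R) = x' ∧
      π x' = x ∧ ∀ g, g ∈ inertiaSubgroup σ' x' := by
  obtain ⟨φ, hφ⟩ := exists_localChart hx hπ ι ht hmap
  have hI : ∀ g, (vanishingIdeal ⟨{x}, hx⟩).comap (σ g).hom = vanishingIdeal ⟨{x}, hx⟩ :=
    vanishingIdeal_comap_eq_of_action σ ⟨{x}, hx⟩ hσx
  have hEC : IsEffectiveCartier ((vanishingIdeal ⟨{x}, hx⟩).comap (φ ≫ π)) := by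
    rw [hφ]
    exact isEffectiveCartier_comap_specMap_fromSpecStalk hx ι ht hmap
  have ha : ∀ g, Spec.map (CommRingCat.ofHom (α g)) ≫ φ ≫ π = φ ≫ π ≫ (σ g).hom := by
    intro g
    rw [hφ, ← Category.assoc φ π, hφ]
    exact specMap_comp_fromSpecStalk_equivariant (fun g => (σ g).hom) a hkey ι α hα g
  let p : Spec (.of (ResidueField R)) ⟶ Spec (.of R) := Spec.map (CommRingCat.ofHom (residue R))
  have hp : ∀ g, p ≫ Spec.map (CommRingCat.ofHom (α g)) = p := fun g =>
    specMap_residue_comp_eq_of_sub_mem (α g) (hres g)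
  have hinert : ∀ g, g ∈ inertiaSubgroup σ' ((p ≫ φ) (closedPoint (ResidueField R))) := fun g =>
    mem_inertiaSubgroup_of_isBlowup_of_fixed_fieldPoint hπ σ σ' hσ' hI hEC ha p hp g
  -- the point `x'`
  have hpc : p (closedPoint (ResidueField R)) = closedPoint R := by
    haveI : IsLocalHom (CommRingCat.ofHom (residue R)).hom := inferInstanceAs (IsLocalHom (residue R))
    exact Spec_closedPoint
  have hx' : (p ≫ φ) (closedPoint (ResidueField R)) = φ (closedPoint R) := by
    rw [Scheme.Hom.comp_apply, hpc]
  refine ⟨φ, φ (closedPoint R), hφ, rfl, ?_, fun g => hx' ▸ hinert g⟩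
  rw [← Scheme.Hom.comp_apply, hφ]
  exact specMap_comp_fromSpecStalk_closedPoint ι

/-- The same for the LIFTED action ✓`IsBlowup.liftAction` on the blow-up along the stable reduced centre `{x}`
(stability: ✓`vanishingIdeal_comap_eq_of_action`). [cite: ReichsteinYoussin2000, Appendix, proof of Prop. A.2] -/
theorem exists_fixedPoint_liftAction_of_localChart (hx : IsClosed ({x} : Set X))
    (hπ : IsBlowup π (vanishingIdeal ⟨{x}, hx⟩)) {G : Type u} [Group G] (σ : G →* Aut X)
    (hσx : ∀ g, (σ g).hom.base ⁻¹' ({x} : Set X) = {x})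
    (a : G → (X.presheaf.stalk x ⟶ X.presheaf.stalk x))
    (hkey : ∀ g, Spec.map (a g) ≫ X.fromSpecStalk x = X.fromSpecStalk x ≫ (σ g).hom)
    {R : Type u} [CommRing R] [IsLocalRing R] (ι : X.presheaf.stalk x →+* R) [IsLocalHom ι]
    {t : R} (ht : t ∈ nonZeroDivisors R) (hmap : (maximalIdeal (X.presheaf.stalk x)).map ι = Ideal.span {t})
    (α : G → (R →+* R)) (hα : ∀ g, (α g).comp ι = ι.comp (a g).hom)
    (hres : ∀ (g : G) (r : R), α g r - r ∈ maximalIdeal R) :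
    ∃ (φ : Spec (.of R) ⟶ X') (x' : X'),
      φ ≫ π = Spec.map (CommRingCat.ofHom ι) ≫ X.fromSpecStalk x ∧ φ (closedPoint R) = x' ∧
      π x' = x ∧
      ∀ g, g ∈ inertiaSubgroup (hπ.liftAction σ (vanishingIdeal_comap_eq_of_action σ ⟨{x}, hx⟩ hσx)) x' :=
  exists_fixedPoint_of_localChart hx hπ σ hσx _ (hπ.liftAction_hom_comp σ _) a hkey ι ht hmap α hα hres

end Summit.ResolutionOfSingularities.ResolutionOfSingularities.Theorems.WildQuotientResolution.KSGoingDown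

end
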